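import Mathlib.Analysis.SpecialFunctions.Pow.Real
import Mathlib.Analysis.InnerProductSpace.PiL2
import Literature.Geometry.DiscreteGeometry.BondGraph
import Literature.MathematicalPhysics.StatisticalMechanics.LennardJonesClusters
import Literature.MathematicalPhysics.StatisticalMechanics.StablePotentialsProofs
import Summits.AtomisticToContinuum.Crystallization.Theorems.ChargedEnergyGap.Negative.FarCopies
import HarnessLib

/-!
# Line `two-tolerance-sandwich` (crux `PricedLinkCensus.ChargedEnergyGap`, stmt-AtomisticToContinuum-14231): regular → separated

Stub `stub_separatedOfRegular` of the line skeleton: the NEAREST-NEIGHBOUR BOUND IS REMOVABLE in a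
priced charge gap relative to the reference energy `e* = ChargedEnergyGapNegative.eStar`.  Write
`E(y) = ∑_{i<j} V_LJ(|yᵢ − yⱼ|)` and `#ch(y)` for the number of CHARGED sites of
`y : Fin N → ℝ³` (sites that are not charge-free at tolerance `1/100`,
`Literature.Geometry.DiscreteGeometry.IsChargeFree`).  A configuration is REGULAR if it is
`1/3`-separated and every site has another site within distance `16` (`nearestDist y i ≤ 16`).
GIVEN (all four as hypotheses, they are the neighbouring stubs of the line)
* the priced gap `N·e* + κ·#ch(y) − C·N^(2/3) ≤ E(y)` on regular injective configurations,
* `e* ≤ −1/4`,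
* the isolated-site bound: in a `1/3`-separated configuration a site `i` with every other site
  at distance `≥ 16` has site energy `∑_{k ≠ i} V_LJ(|yᵢ − y_k|) ≥ −1/10`,
* the recount bound under deletion of one particle, `#ch(x) ≤ #ch(x ∘ i₀.succAbove) + F`,
there are `κ' > 0`, `C'` with `N·e* + κ'·#ch(y) − C'·N^(2/3) ≤ E(y)` for ALL `1/3`-separated
`y`; explicitly `κ' = min κ ((3/20)/(F+1))`, `C' = max C 0`.

Proof (induction on `N`, isolated-site deletion).  A `1/3`-separated configuration is injective
(`dist_self = 0 < 1/3`).  If every `nearestDist y i ≤ 16` it is regular and the hypothesis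
applies (`κ' ≤ κ`, `#ch ≥ 0`, `C ≤ C'`, `N^(2/3) ≥ 0`: `sep_arith`).  Otherwise some site `i₀`
has `nearestDist y i₀ > 16`, hence (`nearestDist_le_dist`) every other site is at distance
`≥ 16` from it and its site energy is `≥ −1/10`; by the removal identity
`interactionEnergy_eq_succAbove_add_siteEnergy`, `E(y) = E(y ∘ i₀.succAbove) + (≥ −1/10)`.
The remaining `N − 1` points are still `1/3`-separated, so the induction hypothesis, the
recount bound (the `+F` charged sites cost `κ'·F ≤ 3/20`), `e* ≤ −1/4` (the extra `e*` on the
left: `−1/4 + 3/20 = −1/10`) and `(N−1)^(2/3) ≤ N^(2/3)` close the step (`step_arith`).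
Case `N = 0`: the empty configuration is regular.  All `[folklore]`.
-/

noncomputable section

namespace Summit.AtomisticToContinuum.Crystallization.Theorems.TwoToleranceSandwichSeparated

open scoped BigOperators Classical
open Literature.MathematicalPhysics.StatisticalMechanics Literature.Geometry.DiscreteGeometry

/-- Arithmetic of the regular case: weakening the constants `κ ↦ κ' ≤ κ`, `C ↦ max C 0`
preserves the inequality since `D ≥ 0` and `r ≥ 0`. [folklore] -/
theorem sep_arith {e κ' κ C N D r Ex : ℝ} (hκ : κ' ≤ κ) (hD : 0 ≤ D) (hr : 0 ≤ r)
    (h : N * e + κ * D - C * r ≤ Ex) : N * e + κ' * D - max C 0 * r ≤ Ex := by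
  have h1 : κ' * D ≤ κ * D := mul_le_mul_of_nonneg_right hκ hD
  have h2 : C * r ≤ max C 0 * r := mul_le_mul_of_nonneg_right (le_max_left _ _) hr
  linarith

/-- Arithmetic of the deletion step: with `κ ≥ 0`, `κ·F ≤ 3/20`, `e ≤ −1/4`, from
`D ≤ D' + F`, `r' ≤ r`, `s ≥ −1/10`, `Ex = Ex' + s` and the induction hypothesis
`n·e + κ·D' − max C 0·r' ≤ Ex'` one gets `(n+1)·e + κ·D − max C 0·r ≤ Ex`
(`−1/4 + 3/20 = −1/10`). [folklore] -/
theorem step_arith {e κ C F n D D' r r' Ex Ex' s : ℝ} (hκ : 0 ≤ κ) (he : e ≤ -(1 / 4 : ℝ))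
    (hκF : κ * F ≤ 3 / 20) (hD : D ≤ D' + F) (hr : r' ≤ r) (hs : -(1 / 10 : ℝ) ≤ s)
    (hE : Ex = Ex' + s) (ih : n * e + κ * D' - max C 0 * r' ≤ Ex') :
    (n + 1) * e + κ * D - max C 0 * r ≤ Ex := by
  have hC' : 0 ≤ max C 0 := le_max_right _ _
  have h1 : κ * D ≤ κ * (D' + F) := mul_le_mul_of_nonneg_left hD hκ
  have h2 : max C 0 * r' ≤ max C 0 * r := mul_le_mul_of_nonneg_left hr hC'
  linarith

/-- **Stub `stub_separatedOfRegular` — the nearest-neighbour bound is removable in a priced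
charge gap (isolated-site deletion, explicit constants).**  Given the priced gap
`N·e* + κ·#ch(y) − C·N^(2/3) ≤ E_LJ(y)` on regular injective configurations (`1/3`-separated,
every `nearestDist ≤ 16`), `e* ≤ −1/4`, the isolated-site bound (site energy `≥ −1/10` for a
site with all other sites at distance `≥ 16` in a `1/3`-separated configuration) and the recount
bound `#ch(x) ≤ #ch(x ∘ i₀.succAbove) + F`, the constants `κ' = min κ ((3/20)/(F+1)) > 0`,
`C' = max C 0` satisfy `N·e* + κ'·#ch(y) − C'·N^(2/3) ≤ E_LJ(y)` for all `1/3`-separated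
`y : Fin N → ℝ³`.  Induction on `N`, deleting a site with `nearestDist > 16`
(`nearestDist_le_dist`, `interactionEnergy_eq_succAbove_add_siteEnergy`), the `+F` recounted
charges costing `κ'·F ≤ 3/20 = −1/10 − e*`-margin. [folklore] -/
theorem stub_separatedOfRegular : (∃ κ C : ℝ, 0 < κ ∧ ∀ (N : ℕ) (y : Fin N → EuclideanSpace ℝ (Fin 3)), Function.Injective y → ((∀ i j : Fin N, i ≠ j → (1 / 3 : ℝ) ≤ dist (y i) (y j)) ∧ ∀ i : Fin N, Literature.Geometry.DiscreteGeometry.nearestDist y i ≤ 16) → (N : ℝ) * Summit.AtomisticToContinuum.Crystallization.Theorems.ChargedEnergyGapNegative.eStar + κ * (Nat.card {i : Fin N // ¬ Literature.Geometry.DiscreteGeometry.IsChargeFree (1 / 100 : ℝ) y i} : ℝ) - C * (N : ℝ) ^ (2 / 3 : ℝ) ≤ Literature.MathematicalPhysics.StatisticalMechanics.interactionEnergy Literature.MathematicalPhysics.StatisticalMechanics.lennardJones y) → Summit.AtomisticToContinuum.Crystallization.Theorems.ChargedEnergyGapNegative.eStar ≤ -(1 / 4 : ℝ) → (∀ (N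 : ℕ) (y : Fin N → EuclideanSpace ℝ (Fin 3)) (i : Fin N), (∀ j k : Fin N, j ≠ k → (1 / 3 : ℝ) ≤ dist (y j) (y k)) → (∀ j : Fin N, j ≠ i → (16 : ℝ) ≤ dist (y i) (y j)) → -(1 / 10 : ℝ) ≤ Literature.MathematicalPhysics.StatisticalMechanics.siteEnergy Literature.MathematicalPhysics.StatisticalMechanics.lennardJones y i) → (∃ F : ℕ, ∀ (N : ℕ) (x : Fin (N + 1) → EuclideanSpace ℝ (Fin 3)) (i₀ : Fin (N + 1)), Function.Injective x → Nat.card {i : Fin (N + 1) // ¬ Literature.Geometry.DiscreteGeometry.IsChargeFree (1 / 100 : ℝ) x i} ≤ Nat.card {i : Fin N // ¬ Literature.Geometry.DiscreteGeometry.IsChargeFree (1 / 100 : ℝ) (x ∘ Fin.succAbove i₀) i} + F) → ∃ κ : ℝ, 0 < κ ∧ ∃ C : ℝ, ∀ (N : ℕ) (y : Fin N → EuclideanSpace ℝ (Fin 3)), (∀ i j : Fin N, i ≠ j → (1 / 3 : ℝ) ≤ dist (y i) (y j)) → (N : ℝ) * Summit.AtomisticToContinuum.Crystallization.Theorems.ChargedEnergyGapNegative.eStar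 + κ * (Nat.card {i : Fin N // ¬ Literature.Geometry.DiscreteGeometry.IsChargeFree (1 / 100 : ℝ) y i} : ℝ) - C * (N : ℝ) ^ (2 / 3 : ℝ) ≤ Literature.MathematicalPhysics.StatisticalMechanics.interactionEnergy Literature.MathematicalPhysics.StatisticalMechanics.lennardJones y := by
  rintro ⟨κ, C, hκ, hreg⟩ he hiso ⟨F, hF⟩
  have hκpos : 0 < min κ (3 / 20 / ((F : ℝ) + 1)) := lt_min hκ (by positivity)
  refine ⟨min κ (3 / 20 / ((F : ℝ) + 1)), hκpos, max C 0, ?_⟩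
  have hκF : min κ (3 / 20 / ((F : ℝ) + 1)) * F ≤ 3 / 20 := by
    calc min κ (3 / 20 / ((F : ℝ) + 1)) * F
        ≤ 3 / 20 / ((F : ℝ) + 1) * ((F : ℝ) + 1) :=
          mul_le_mul (min_le_right _ _) (by linarith) (Nat.cast_nonneg _) (by positivity)
      _ = 3 / 20 := div_mul_cancel₀ _ (by positivity)
  intro N
  induction N with
  | zero =>
    intro y hy
    exact sep_arith (min_le_left _ _) (Nat.cast_nonneg _) (Real.rpow_nonneg (Nat.cast_nonneg _) _)
      (hreg 0 y (fun i => i.elim0) ⟨hy, fun i => i.elim0⟩)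
  | succ n ih =>
    intro y hy
    -- a `1/3`-separated configuration is injective (`dist_self = 0 < 1/3`)
    have hinj : Function.Injective y := by
      intro i j hij
      by_contra h
      have h1 := hy i j h
      rw [hij, dist_self] at h1
      norm_num at h1
    by_cases hs : ∀ i : Fin (n + 1), nearestDist y i ≤ 16
    · exact sep_arith (min_le_left _ _) (Nat.cast_nonneg _)
        (Real.rpow_nonneg (Nat.cast_nonneg _) _) (hreg (n + 1) y hinj ⟨hy, hs⟩)
    push Not at hs
    obtain ⟨i₀, hi₀⟩ := hs
    -- delete the isolated site `i₀`: every other site is at distance `≥ 16` from it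
    have hfar : ∀ j : Fin (n + 1), j ≠ i₀ → (16 : ℝ) ≤ dist (y i₀) (y j) := fun j hj =>
      (hi₀.trans_le (nearestDist_le_dist y hj)).le
    have hsite : -(1 / 10 : ℝ) ≤ siteEnergy lennardJones y i₀ := hiso (n + 1) y i₀ hy hfar
    have hy' : ∀ i j : Fin n, i ≠ j →
        (1 / 3 : ℝ) ≤ dist ((y ∘ i₀.succAbove) i) ((y ∘ i₀.succAbove) j) :=
      fun i j hij => hy _ _ (Fin.succAbove_right_injective.ne hij)
    have hE : interactionEnergy lennardJones y =
        interactionEnergy lennardJones (y ∘ i₀.succAbove) + siteEnergy lennardJones y i₀ :=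
      interactionEnergy_eq_succAbove_add_siteEnergy lennardJones lennardJones_zero y i₀
    -- the induction hypothesis for the remaining `n` points and the recount bound
    have hih := ih (y ∘ i₀.succAbove) hy'
    have hDR := (Nat.cast_le (α := ℝ)).2 (hF n y i₀ hinj)
    push_cast at hDR
    have hrpow : (n : ℝ) ^ (2 / 3 : ℝ) ≤ ((n : ℝ) + 1) ^ (2 / 3 : ℝ) :=
      Real.rpow_le_rpow (Nat.cast_nonneg _) (by linarith) (by norm_num)
    rw [Nat.cast_succ]
    exact step_arith hκpos.le he hκF hDR hrpow hsite hE hih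

end Summit.AtomisticToContinuum.Crystallization.Theorems.TwoToleranceSandwichSeparated

end
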